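import Summits.QuantumFields.BalabanUV.Beta.D1BFx.Assembly
import Summits.QuantumFields.BalabanUV.Beta.D1BFx.ReducedKernelSandwich
import Summits.QuantumFields.BalabanUV.Beta.D1BFx.GluonKernelSectors
import Summits.QuantumFields.BalabanUV.Beta.D1BFx.SecondStencilBF
import Summits.QuantumFields.BalabanUV.Beta.D1BFx.DressedTablesLeg
import Summits.QuantumFields.BalabanUV.Beta.D1BFx.PackedKernelSplit

/-!
# `BalabanUV.Beta.D1BFx.FineHessianSectors` — road «BF-x» for binder row D1, leaf A0 (fine level, part 1): THE SECTOR × SLOT EXPANSION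
# OF THE GLUON PIECE'S FINE HESSIAN KERNEL — `fineHess n a SbfBal (Wbf …)` = FIVE tadpole-slot tables + NINE two-sector bubble tables,
# each a block-periodic fine kernel with absolutely summable base-point kernels, i.e. an admissible (F)/(CONV) integrand of `D1BFx.Assembly`;
# the words are typed with TWO LEGS (`biBubbleTable A B S T`, my lineage's `PackedKernelSplit.biBubble`) so that the leg-grade split composes on top

HONEST DEPENDENCY (page 1, mandatory): continuum YM on T⁴ ⇐ BetaPertH ∧ nine spine estimates (0/9 proved); BetaPertH ⇐ (D1) ∧ (D4) ∧
CAP+tail; G-an2-4 gates asym, D1 and NE2/3/4.  HONEST FRAMING (cell contract, verbatim): «discharging `BetaPertH` makes Bałaban's UV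
stability UNCONDITIONAL — a real constructive-QFT result; it is NOT the continuum limit and NOT the Clay problem.»  THIS MODULE DISCHARGES
NOTHING of the wall: THREE definitions with bodies ([our object] the two-leg two-family fine bubble table `biBubbleTable` and the `Fin 5` packers
`slotWt`/`slotTab` of T5-asm's slots) and [folklore] LINEAR ALGEBRA
OF ABSOLUTELY CONVERGENT LATTICE SUMS (bilinearity of the bubble / linearity of the tadpole on localised vertices over a spread leg:
`TameKernelCalculus.tadpole_add` / `bubble_add_*`, an1's `KernelWardRelative.tadpole_finset_sum` / `bubble_finset_sum_left`, leaf-01's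
`DressedBubbleBridge.bubble_finset_sum_right`, an5's `KernelReflection.bubble_smul_*` / `tadpole_smul`) composed BY NAME over leaf A4
(`ReducedKernelSandwich.fineHess`, `DressedBubbleTable.bubbleTable`, `DressedTadpoleTable.tadpoleTable`, leaf-01-g2's generic-leg
`DressedTablesLeg`), leaf-05-g3's A0-sec (`GluonKernelSectors.secSt` / `secWt` / `SbfBal_eq_secSum` / `exists_biLoc_secSt`), the typer's T5-asm
(`SecondStencilBF.Wbf`), my lineage's K-R2-SPLIT (`PackedKernelSplit.biBubble`) and the owner's A7 (`Assembly.exists_tendsto_psum_weight_mul`).  No `Prop` is minted, nothing is cited, no hypothesis is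
a printed statement, 0 sorry.  0 wall binders instantiated; NOT the (SPLIT) slot, NOT D1, NOT `BetaPertH`, NOT continuum, NOT Clay.

ABSOLUTE RULE (cell charter, verbatim): «No internally-minted statement may enter as a cited fact. Every hypothesis is either kernel-proved in
this package or a verbatim quotation of a PUBLISHED theorem with page reference. The manuscript(s) under audit are NOT citable for their own
disputed steps — they are the thing under adjudication; programme-internal (2001/route/tribunal) claims are never citable.»

WHY (skeleton `HOME/beta/skeletons/D1-b2b-balaban-beta-d1-p2.md` v1.6 amendments, slot (SPLIT): «A0 = the FINE-LEVEL sector × leg-grade expansion of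
`fineHess n a SbfBal Wbf` … (`GluonKernelSectors.Pgl_eq_sectors` one level down)»; owner table `LEAVES-BFx.md` INTEGRATION #3, OPEN list «A0 fine-level
sector × grade expansion — first refusal any seat»).  In `Assembly.defect_eq_of_slots` the reduced gluon piece enters slot (F) through the fine
integrand `Kf n b w = n⁻⁸·w_μw_ν·baseKer (fineHess n a S Wf μ ν) b w` (`AssemblySlots.hF_TOfRed`, `S := SbfBal …`, `Wf := Wbf …`), and slot
(SPLIT) asks for the POINTWISE identity `Σ_i ω i n · Kf i n b w = stK μ ν N (Gf n b) w + Σ_τ Kr τ n b w`.  THIS FILE is the first layer of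
that identity for the gluon piece, with NO estimate and NO identification: the fine Hessian kernel is LINEAR in the second-order table and
BILINEAR in the first-order stencil, so with `SbfBal = Σ_{i<3} secWt i • secSt i` (E, Λ, R sectors) and `Wbf = Σ_{s<5} c_s • W_s` (E₂, J4, Λ₂, R₂,
Q₂ slots) it is the sum of FIVE tadpole-slot tables and NINE two-sector bubble tables — every one of them again a block-periodic fine kernel with
absolutely second-moment-summable base-point kernels, hence an admissible `Kf`/`Kr` integrand carrying its own (CONV).  The parents of the
census rows (`A0-TERM-CENSUS.md`): EE ↦ MAIN-gl + deg≥7 (A1.ii/A2), EΛ/ER ↦ τ4/τ5 (A3.a), ΛΛ/ΛR/RR ↦ τ3/τ6 (A3.b), E₂/R₂-loc slots ↦ tad-loc /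
RR-loc (A6 / A1.ii), the block parts of the slots ↦ tad-blk (A3.a) — orientation only; which word is MAIN and every bound are the A-leaves'.

CONTENT (`d = 4`; block side `n`, `[NeZero n]`; weight `a`).
* §1 [our object] `biBubbleTable A B S T κ′ λ′ u u′ := −½·biBubble A (S κ′ u) B (T λ′ u′)` over TWO generic legs `A B : MKer 4 F` and TWO stencil
  families (`biBubbleTable A A S S = bubbleTableA A S`, `biBubbleTable (Ga n a) (Ga n a) S S = bubbleTable n a S` by `rfl`); [folklore] `biBubble_shiftK`,
  block periodicity (`isBlockPeriodic_biBubbleTable`), the transpose law `biBubbleTable A B S T κ′ λ′ u u′ = biBubbleTable B A T S λ′ κ′ u′ u` (trace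
  cyclicity), exponential localisation in the separation (`exists_decay_biBubbleTable`) and `absMoment₂_baseKer_biBubbleTable` — from `Spr A`, `Spr B` +
  `BiLoc` of `S`, `T` only.
* §2 [folklore] THE BUBBLE IS BILINEAR OVER WEIGHTED FINITE FAMILIES of localised vertices (`bubble_weightedSum_weightedSum`, any `D`, any fibre) and
  **`bubbleTable_SbfBal_eq_secSum`**: `bubbleTable n a (SbfBal …) κ′ λ′ u u′ = Σ_{i j : Fin 3} secWt i · secWt j · biBubbleTable (Ga n a) (Ga n a) (secSt i) (secSt j) κ′ λ′ u u′`
  (binders: `Spr (Ga n a)` — T1's standing decay binder — and `0 < a`).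
* §3 [folklore] THE TADPOLE TABLE IS LINEAR IN THE FIVE SLOTS: [our objects] the packers `slotWt`, `slotTab` (`Fin 5`-families, like A0-sec's
  `secWt`/`secSt`), `Wbf_eq_slotSum`, **`tadpoleTable_Wbf_eq_slotSum`** (binders: `Spr (Ga n a)` and `Loc` of every slot entry).
* §4 [folklore] **`fineHess_SbfBal_Wbf_eq_terms`**, **`baseKer_fineHess_SbfBal_Wbf_eq_terms`** and the (F)-integrand form **`Kf_gluon_eq_terms`**
  (`n⁻⁸·w_μw_ν·baseKer (fineHess …) b w` = the same weighted combination of the 5 + 9 term integrands); (CONV) per term: `conv_tadpoleTable_slot`,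
  `conv_biBubbleTable_sectors` (from `Assembly.exists_tendsto_psum_weight_mul`).
NOT HERE (honest): the LEG-GRADE split of `Ga` (diagonal / off-diagonal fibre entries; part 2 splits the two legs of `biBubbleTable`), the ghost piece (`GhostKernelComplete.fineHessGhQ` is ONE
sector over the scalar leg `Ggh` — nothing to expand at this level), which word is MAIN (A1.ii), any bound (A2/A3/A5/A6), loop weights `ω` (slot (K)).
Unit `b2b-balaban-beta-d1-formalise-leaf-03` (gen 3), D1 formalisation swarm; `LEAVES-BFx.md` row A0 (sub-leaf A0-FINE part 1).
-/

noncomputable section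

namespace Summit.QuantumFields.BalabanUV.Beta.D1BFx.FineHessianSectors

open Finset Filter Topology
open scoped BigOperators
open Literature.MathematicalPhysics.QuantumFieldTheory.Balaban1983to89
open Literature.MathematicalPhysics.QuantumFieldTheory.Balaban1983to89.Beta
open B12Sec2to5 (l1 l1_nonneg Decay510)
open ExpKernelCalculus (Site MKer Decays BiLoc comp tr bubble tadpole shiftK comp_shiftK tr_shiftK Zl Zl_nonneg biLoc_comp_decays
  biLoc_comp_biLoc abs_tr_le)
open DecimatedMomentSummable (AbsMoment₂ absMoment₂_of_decay510)
open WindowIdentification (psum)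
open DyadicShell (Pt toReal)
open KernelReflection (bubble_smul_left bubble_smul_right tadpole_smul)
open Summit.QuantumFields.BalabanUV.Beta.TameKernelCalculus
open Summit.QuantumFields.BalabanUV.Beta.KernelWardRelative (loc_finset_sum tadpole_finset_sum bubble_finset_sum_left)
open Summit.QuantumFields.BalabanUV.Beta.D1BFx.DressedBubbleBridge (bubble_finset_sum_right biLoc_const_mono)
open Summit.QuantumFields.BalabanUV.Beta.D1BFx.GluonLeg (Ga)
open Summit.QuantumFields.BalabanUV.Beta.D1BFx.ReducedKernel (StencilR TableR)
open Summit.QuantumFields.BalabanUV.Beta.D1BFx.DressedBubbleTable (bubbleTable bubbleTable_apply)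
open Summit.QuantumFields.BalabanUV.Beta.D1BFx.DressedTadpoleTable (Table₂R tadpoleTable tadpoleTable_apply absMoment₂_baseKer_tadpoleTable)
open Summit.QuantumFields.BalabanUV.Beta.D1BFx.DressedTablesLeg (bubbleTableA)
open Summit.QuantumFields.BalabanUV.Beta.D1BFx.PackedKernelSplit (biBubble bubble_eq_biBubble)
open Summit.QuantumFields.BalabanUV.Beta.D1BFx.ReducedKernelSandwich (fineHess fineHess_apply)
open Summit.QuantumFields.BalabanUV.Beta.D1BFx.MomentTransferPeriodic (IsBlockPeriodic baseKer)
open Summit.QuantumFields.BalabanUV.Beta.D1BFx.MomentTransferPeriodicEntry (EKer₂)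
open Summit.QuantumFields.BalabanUV.Beta.D1BFx.FineStencilBFBalaban (SbfBal)
open Summit.QuantumFields.BalabanUV.Beta.D1BFx.GluonKernelSectors (secSt secWt SbfBal_eq_secSum exists_biLoc_secSt)
open Summit.QuantumFields.BalabanUV.Beta.D1BFx.SecondStencilBF (Wbf Wbf_apply)
open Summit.QuantumFields.BalabanUV.Beta.D1BFx.Assembly (exists_tendsto_psum_weight_mul exists_tendsto_psum_const_mul)

variable {F : Type*} [Fintype F]

/-! ## §1 The two-leg, two-family fine bubble table -/

omit [Fintype F] in
/-- [folklore] The two-leg bubble is invariant under a common translation of legs and vertices (`comp_shiftK`, `tr_shiftK`). -/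
theorem biBubble_shiftK [Fintype F] {D : ℕ} (v : Site D) (A V B W : MKer D F) :
    biBubble (shiftK v A) (shiftK v V) (shiftK v B) (shiftK v W) = biBubble A V B W := by
  simp only [biBubble, comp_shiftK, tr_shiftK]

/-- [our object] **THE TWO-LEG, TWO-FAMILY FINE BUBBLE TABLE** over the legs `A`, `B` of two first-order fine stencil families `S`, `T`:
`biBubbleTable A B S T κ′ λ′ u u′ := −½ · biBubble A (S κ′ u) B (T λ′ u′) = −½ · tr ((A ∘ S κ′ u) ∘ (B ∘ T λ′ u′))` — the words of the
sector expansion (two families) AND of the leg-grade expansion (two legs) of the fine bubble table.  A DEFINITION; asserts nothing.  On the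
diagonal `A = B`, `S = T` it is leaf-01-g2's `bubbleTableA A S` (and at `A := Ga n a` leaf A4's `bubbleTable n a S`). -/
def biBubbleTable (A B : MKer 4 F) (S T : Fin 4 → Site 4 → MKer 4 F) : EKer₂ 4 :=
  fun κ' l' u u' => -(1 / 2 : ℝ) * biBubble A (S κ' u) B (T l' u')

/-- [our object] Unfolding. -/
theorem biBubbleTable_apply (A B : MKer 4 F) (S T : Fin 4 → Site 4 → MKer 4 F) (κ' l' : Fin 4) (u u' : Site 4) :
    biBubbleTable A B S T κ' l' u u' = -(1 / 2 : ℝ) * biBubble A (S κ' u) B (T l' u') := rfl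

/-- [folklore] On the diagonal the two-leg two-family table IS the one-family table of `DressedTablesLeg` (definitionally). -/
theorem biBubbleTable_self (A : MKer 4 F) (S : Fin 4 → Site 4 → MKer 4 F) : biBubbleTable A A S S = bubbleTableA A S := rfl

/-- [folklore] … and at the gluon leg it IS leaf A4's `bubbleTable n a` (definitionally). -/
theorem biBubbleTable_Ga_self (n : ℕ) [NeZero n] (a : ℝ) (S : StencilR) : biBubbleTable (Ga n a) (Ga n a) S S = bubbleTable n a S := rfl

variable (n : ℕ) [NeZero n] (A B : MKer 4 F)

omit [NeZero n] in
/-- [folklore] **BLOCK PERIODICITY** of every entry of the table, for block-covariant legs (`shiftK (−n•t) A = A`, same for `B`) and two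
fine-translation-covariant stencil families (`biBubble_shiftK`). -/
theorem isBlockPeriodic_biBubbleTable (hA : ∀ t : Site 4, shiftK (-((n : ℤ) • t)) A = A) (hB : ∀ t : Site 4, shiftK (-((n : ℤ) • t)) B = B)
    {S T : Fin 4 → Site 4 → MKer 4 F} (hS : ∀ (κ' : Fin 4) (u v : Site 4), S κ' (u + v) = shiftK (-v) (S κ' u))
    (hT : ∀ (κ' : Fin 4) (u v : Site 4), T κ' (u + v) = shiftK (-v) (T κ' u)) (κ' l' : Fin 4) :
    IsBlockPeriodic n (biBubbleTable A B S T κ' l') := by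
  intro t s s'
  simp only [biBubbleTable_apply]
  rw [hS κ' s ((n : ℤ) • t), hT l' s' ((n : ℤ) • t)]
  conv_lhs => rw [← hA t, ← hB t]
  rw [biBubble_shiftK]

/-- [folklore] **THE TRANSPOSE LAW** (spread legs, localised stencils; cyclicity of the trace `TameKernelCalculus.tr_comp_comm_loc`):
`biBubbleTable A B S T κ′ λ′ u u′ = biBubbleTable B A T S λ′ κ′ u′ u`. -/
theorem biBubbleTable_transpose {S T : Fin 4 → Site 4 → MKer 4 F} (hA : Spr A) (hB : Spr B) {Cs δs Ct δt : ℝ}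
    (hS : ∀ κ' u, BiLoc (S κ' u) u u Cs δs) (hδs : 0 < δs) (hT : ∀ κ' u, BiLoc (T κ' u) u u Ct δt) (hδt : 0 < δt)
    (κ' l' : Fin 4) (u u' : Site 4) : biBubbleTable A B S T κ' l' u u' = biBubbleTable B A T S l' κ' u' u := by
  simp only [biBubbleTable_apply, biBubble]
  rw [tr_comp_comm_loc (hA.comp_loc ⟨u, u, Cs, δs, hδs, hS κ' u⟩) (hB.comp_loc ⟨u', u', Ct, δt, hδt, hT l' u'⟩).tame]

/-- [folklore] **EXPONENTIAL LOCALISATION OF THE TABLE IN THE SEPARATION**: `|P κ′λ′ (b + t) b| ≤ C′ e^{−δ′|t|₁}` with ONE pair `(C′, δ′)` for all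
entries and base points (the two legs `A ∘ S κ′ (b+t)`, `B ∘ T λ′ b` are bi-localised at `b + t` resp. `b`; their product decays in `t`). -/
theorem exists_decay_biBubbleTable {S T : Fin 4 → Site 4 → MKer 4 F} (hA : Spr A) (hB : Spr B) {Cs δs Ct δt : ℝ}
    (hS : ∀ κ' u, BiLoc (S κ' u) u u Cs δs) (hδs : 0 < δs) (hT : ∀ κ' u, BiLoc (T κ' u) u u Ct δt) (hδt : 0 < δt) :
    ∃ C' δ' : ℝ, 0 < δ' ∧ ∀ (κ' l' : Fin 4) (b : Site 4), Decay510 (baseKer (biBubbleTable A B S T κ' l') b) C' δ' := by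
  obtain ⟨CA, δA, hδA, hAd⟩ := hA
  obtain ⟨CB, δB, hδB, hBd⟩ := hB
  set m : ℝ := min (min δA δB) (min δs δt) with hm
  have hm0 : 0 < m := lt_min (lt_min hδA hδB) (lt_min hδs hδt)
  have hm2 : 0 < m / 2 := half_pos hm0
  have hAd' : Decays A (|CA|) m := decays_of_le hAd ((min_le_left _ _).trans (min_le_left _ _))
  have hBd' : Decays B (|CB|) m := decays_of_le hBd ((min_le_left _ _).trans (min_le_right _ _))
  have hS' : ∀ κ' u, BiLoc (S κ' u) u u (|Cs|) m := fun κ' u =>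
    biLoc_of_le (hS κ' u) ((min_le_right _ _).trans (min_le_left _ _))
  have hT' : ∀ κ' u, BiLoc (T κ' u) u u (|Ct|) m := fun κ' u =>
    biLoc_of_le (hT κ' u) ((min_le_right _ _).trans (min_le_right _ _))
  set C1 : ℝ := (Fintype.card F : ℝ) * (|CA| * |Cs|) * Zl 4 (m - m / 2)
  set C2 : ℝ := (Fintype.card F : ℝ) * (|CB| * |Ct|) * Zl 4 (m - m / 2)
  set C3 : ℝ := (Fintype.card F : ℝ) * (C1 * C2) * Zl 4 (m / 2 / 2)
  have hC10 : 0 ≤ C1 := mul_nonneg (by positivity) (Zl_nonneg (by linarith))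
  have hC20 : 0 ≤ C2 := mul_nonneg (by positivity) (Zl_nonneg (by linarith))
  have hC30 : 0 ≤ C3 := mul_nonneg (mul_nonneg (Nat.cast_nonneg _) (mul_nonneg hC10 hC20)) (Zl_nonneg (by linarith))
  refine ⟨1 / 2 * ((Fintype.card F : ℝ) * C3 * Zl 4 (m / 2 / 2)), m / 2 / 2, by positivity, fun κ' l' b t => ?_⟩
  have h1 : BiLoc (comp A (S κ' (b + t))) (b + t) (b + t) C1 (m / 2) :=
    biLoc_comp_decays hAd' (hS' κ' (b + t)) hm2.le (by linarith)
  have h2 : BiLoc (comp B (T l' b)) b b C2 (m / 2) := biLoc_comp_decays hBd' (hT' l' b) hm2.le (by linarith)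
  have h3 : BiLoc (comp (comp A (S κ' (b + t))) (comp B (T l' b))) (b + t) b C3 (m / 2) :=
    biLoc_const_mono (biLoc_comp_biLoc h1 h2 hm2)
      (mul_le_of_le_one_right hC30 (Real.exp_le_one_iff.2 (by nlinarith [l1_nonneg (b + t - b)])))
  have h4 := abs_tr_le h3 hm2
  rw [add_sub_cancel_left] at h4
  simp only [baseKer, biBubbleTable_apply, biBubble, abs_mul]
  rw [show |(-(1 / 2 : ℝ))| = 1 / 2 by norm_num, mul_assoc]
  exact mul_le_mul_of_nonneg_left h4 (by norm_num)

/-- [folklore] Hence every base-point kernel of every entry of the table has an absolutely summable second moment. -/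
theorem absMoment₂_baseKer_biBubbleTable {S T : Fin 4 → Site 4 → MKer 4 F} (hA : Spr A) (hB : Spr B) {Cs δs Ct δt : ℝ}
    (hS : ∀ κ' u, BiLoc (S κ' u) u u Cs δs) (hδs : 0 < δs) (hT : ∀ κ' u, BiLoc (T κ' u) u u Ct δt) (hδt : 0 < δt)
    (κ' l' : Fin 4) (b : Site 4) : AbsMoment₂ (baseKer (biBubbleTable A B S T κ' l') b) := by
  obtain ⟨C', δ', hδ', h⟩ := exists_decay_biBubbleTable A B hA hB hS hδs hT hδt
  exact absMoment₂_of_decay510 hδ' (h κ' l' b)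

/-! ## §2 Bilinearity of the bubble over weighted finite families; the sector expansion of the fine bubble table -/

omit [Fintype F] in
/-- [folklore] **THE BUBBLE IS BILINEAR OVER WEIGHTED FINITE FAMILIES OF LOCALISED VERTICES** (spread leg; any dimension, any fibre):
`bubble A (Σ_i c_i • V_i) (Σ_j d_j • W_j) = Σ_i Σ_j c_i · d_j · bubble A V_i W_j`. -/
theorem bubble_weightedSum_weightedSum [Fintype F] {D : ℕ} {ι υ : Type*} (s : Finset ι) (t : Finset υ) {A : MKer D F} (hA : Spr A)
    (c : ι → ℝ) (e : υ → ℝ) {V : ι → MKer D F} {W : υ → MKer D F} (hV : ∀ i, Loc (V i)) (hW : ∀ j, Loc (W j)) :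
    bubble A (∑ i ∈ s, c i • V i) (∑ j ∈ t, e j • W j) = ∑ i ∈ s, ∑ j ∈ t, c i * e j * bubble A (V i) (W j) := by
  rw [bubble_finset_sum_left s hA (fun i => (hV i).smul (c i)) (loc_finset_sum t fun j => (hW j).smul (e j))]
  refine Finset.sum_congr rfl fun i _ => ?_
  rw [bubble_finset_sum_right t hA ((hV i).smul (c i)) (fun j => (hW j).smul (e j))]
  refine Finset.sum_congr rfl fun j _ => ?_
  rw [bubble_smul_left, bubble_smul_right]
  ring

variable (a : ℝ) (cE cVH cΛ cR cK cQ : ℝ)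

/-- [folklore] Every sector stencil of A0-sec is localised in the `TameKernelCalculus` sense (`exists_biLoc_secSt`; `0 < a`). -/
theorem loc_secSt (ha : 0 < a) (i : Fin 3) (κ : Fin 4) (u : Site 4) : Loc (secSt n a cK cQ i κ u) := by
  obtain ⟨Cs, δ, hδ, h⟩ := exists_biLoc_secSt n a cK cQ ha i
  exact ⟨u, u, Cs, δ, hδ, h κ u⟩

/-- [folklore] **A0 AT THE FINE LEVEL — THE SECTOR EXPANSION OF THE FINE BUBBLE TABLE OF THE GLUON PIECE.**  Under T1's standing binder
`Spr (Ga n a)` (so the bubble converges absolutely and is bilinear) and `0 < a`: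
`bubbleTable n a (SbfBal …) κ′ λ′ u u′ = Σ_{i j : Fin 3} secWt i · secWt j · biBubbleTable (Ga n a) (Ga n a) (secSt i) (secSt j) κ′ λ′ u u′` — NINE two-sector
fine bubble tables (EE, EΛ, ER, ΛE, ΛΛ, ΛR, RE, RΛ, RR): `GluonKernelSectors.Pgl_eq_sectors` ONE LEVEL DOWN (no `ℋ`-dressing). -/
theorem bubbleTable_SbfBal_eq_secSum (ha : 0 < a) (hGa : Spr (Ga n a)) (κ' l' : Fin 4) (u u' : Site 4) :
    bubbleTable n a (SbfBal n a cE cVH cΛ cR cK cQ) κ' l' u u' =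
      ∑ i : Fin 3, ∑ j : Fin 3, secWt cE cΛ cR i * secWt cE cΛ cR j *
        biBubbleTable (Ga n a) (Ga n a) (secSt n a cK cQ i) (secSt n a cK cQ j) κ' l' u u' := by
  rw [bubbleTable_apply, SbfBal_eq_secSum, SbfBal_eq_secSum,
    bubble_weightedSum_weightedSum univ univ hGa _ _ (fun i => loc_secSt n a cK cQ ha i κ' u) (fun j => loc_secSt n a cK cQ ha j l' u'),
    Finset.mul_sum]
  refine Finset.sum_congr rfl fun i _ => ?_
  rw [Finset.mul_sum]
  refine Finset.sum_congr rfl fun j _ => ?_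
  rw [biBubbleTable_apply, ← bubble_eq_biBubble]
  ring

/-- [folklore] The gluon fine bubble table does not see the vh weight `cVH` (the vh sector has no field–field block). -/
theorem bubbleTable_SbfBal_indep_cVH (cVH' : ℝ) :
    bubbleTable n a (SbfBal n a cE cVH cΛ cR cK cQ) = bubbleTable n a (SbfBal n a cE cVH' cΛ cR cK cQ) := by
  have e : SbfBal n a cE cVH cΛ cR cK cQ = SbfBal n a cE cVH' cΛ cR cK cQ := by
    funext κ u; rw [SbfBal_eq_secSum, SbfBal_eq_secSum]
  rw [e]

/-! ## §3 Linearity of the fine tadpole table in the five second-order slots -/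

variable (cE₂ cJ4 cΛ₂ cR₂ cQ₂ : ℝ) (WE WJ WΛ WR WQ : TableR)

/-- [our object] The five slot weights of T5-asm's `Wbf` packed as a `Fin 5`-family: `0 ↦ cE₂`, `1 ↦ cJ4`, `2 ↦ cΛ₂`, `3 ↦ cR₂`, `4 ↦ cQ₂`. -/
def slotWt (cE₂ cJ4 cΛ₂ cR₂ cQ₂ : ℝ) : Fin 5 → ℝ := ![cE₂, cJ4, cΛ₂, cR₂, cQ₂]

/-- [our object] The five slot tables of T5-asm's `Wbf` packed as a `Fin 5`-family: `0 ↦ WE`, `1 ↦ WJ`, `2 ↦ WΛ`, `3 ↦ WR`, `4 ↦ WQ`. -/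
def slotTab (WE WJ WΛ WR WQ : TableR) : Fin 5 → TableR := ![WE, WJ, WΛ, WR, WQ]

/-- [folklore] **T5-asm's TABLE IS THE WEIGHTED SUM OF ITS FIVE SLOTS** (bondwise, as kernels). -/
theorem Wbf_eq_slotSum (κ : Fin 4) (u : Site 4) (l : Fin 4) (u' : Site 4) :
    Wbf cE₂ cJ4 cΛ₂ cR₂ cQ₂ WE WJ WΛ WR WQ κ u l u' =
      ∑ s : Fin 5, slotWt cE₂ cJ4 cΛ₂ cR₂ cQ₂ s • slotTab WE WJ WΛ WR WQ s κ u l u' := by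
  simp only [Wbf_apply, Fin.sum_univ_five, slotWt, slotTab, Matrix.cons_val_zero, Matrix.cons_val_one, Matrix.cons_val]

/-- [folklore] **THE FINE TADPOLE TABLE IS LINEAR IN THE FIVE SLOTS** (spread leg, every slot entry localised:
`KernelWardRelative.tadpole_finset_sum` + `KernelReflection.tadpole_smul`):
`tadpoleTable n a (Wbf …) κ′ λ′ u u′ = Σ_{s : Fin 5} slotWt s · tadpoleTable n a (slotTab s) κ′ λ′ u u′`. -/
theorem tadpoleTable_Wbf_eq_slotSum (hGa : Spr (Ga n a)) (hE : ∀ κ u l u', Loc (WE κ u l u')) (hJ : ∀ κ u l u', Loc (WJ κ u l u'))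
    (hΛ : ∀ κ u l u', Loc (WΛ κ u l u')) (hR : ∀ κ u l u', Loc (WR κ u l u')) (hQ : ∀ κ u l u', Loc (WQ κ u l u'))
    (κ' l' : Fin 4) (u u' : Site 4) :
    tadpoleTable n a (Wbf cE₂ cJ4 cΛ₂ cR₂ cQ₂ WE WJ WΛ WR WQ) κ' l' u u' =
      ∑ s : Fin 5, slotWt cE₂ cJ4 cΛ₂ cR₂ cQ₂ s * tadpoleTable n a (slotTab WE WJ WΛ WR WQ s) κ' l' u u' := by
  have hslot : ∀ s : Fin 5, Loc (slotTab WE WJ WΛ WR WQ s κ' u l' u') := by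
    intro s
    fin_cases s
    · exact hE κ' u l' u'
    · exact hJ κ' u l' u'
    · exact hΛ κ' u l' u'
    · exact hR κ' u l' u'
    · exact hQ κ' u l' u'
  have e : Wbf cE₂ cJ4 cΛ₂ cR₂ cQ₂ WE WJ WΛ WR WQ κ' u l' u' =
      ∑ s : Fin 5, slotWt cE₂ cJ4 cΛ₂ cR₂ cQ₂ s • slotTab WE WJ WΛ WR WQ s κ' u l' u' := Wbf_eq_slotSum cE₂ cJ4 cΛ₂ cR₂ cQ₂ WE WJ WΛ WR WQ κ' u l' u'
  rw [tadpoleTable_apply, e, tadpole_finset_sum univ hGa (fun s => (hslot s).smul _), Finset.mul_sum]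
  refine Finset.sum_congr rfl fun s _ => ?_
  rw [tadpole_smul, tadpoleTable_apply]
  ring

/-- [folklore] The five-slot sum written out. -/
theorem tadpoleTable_Wbf_eq_slots (hGa : Spr (Ga n a)) (hE : ∀ κ u l u', Loc (WE κ u l u')) (hJ : ∀ κ u l u', Loc (WJ κ u l u'))
    (hΛ : ∀ κ u l u', Loc (WΛ κ u l u')) (hR : ∀ κ u l u', Loc (WR κ u l u')) (hQ : ∀ κ u l u', Loc (WQ κ u l u'))
    (κ' l' : Fin 4) (u u' : Site 4) :
    tadpoleTable n a (Wbf cE₂ cJ4 cΛ₂ cR₂ cQ₂ WE WJ WΛ WR WQ) κ' l' u u' =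
      cE₂ * tadpoleTable n a WE κ' l' u u' + cJ4 * tadpoleTable n a WJ κ' l' u u' + cΛ₂ * tadpoleTable n a WΛ κ' l' u u' +
        cR₂ * tadpoleTable n a WR κ' l' u u' + cQ₂ * tadpoleTable n a WQ κ' l' u u' := by
  rw [tadpoleTable_Wbf_eq_slotSum n a cE₂ cJ4 cΛ₂ cR₂ cQ₂ WE WJ WΛ WR WQ hGa hE hJ hΛ hR hQ, Fin.sum_univ_five]
  simp only [slotWt, slotTab, Matrix.cons_val_zero, Matrix.cons_val_one, Matrix.cons_val]

/-! ## §4 The fine Hessian kernel of the gluon piece as 5 + 9 named terms; the (F)-integrand form; (CONV) per term -/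

/-- [folklore] **THE FINE HESSIAN KERNEL OF THE GLUON PIECE, TERM BY TERM**: five tadpole-slot tables plus nine two-sector bubble tables. -/
theorem fineHess_SbfBal_Wbf_eq_terms (ha : 0 < a) (hGa : Spr (Ga n a)) (hE : ∀ κ u l u', Loc (WE κ u l u'))
    (hJ : ∀ κ u l u', Loc (WJ κ u l u')) (hΛ : ∀ κ u l u', Loc (WΛ κ u l u')) (hR : ∀ κ u l u', Loc (WR κ u l u'))
    (hQ : ∀ κ u l u', Loc (WQ κ u l u')) (κ' l' : Fin 4) (u u' : Site 4) :
    fineHess n a (SbfBal n a cE cVH cΛ cR cK cQ) (Wbf cE₂ cJ4 cΛ₂ cR₂ cQ₂ WE WJ WΛ WR WQ) κ' l' u u' =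
      (∑ s : Fin 5, slotWt cE₂ cJ4 cΛ₂ cR₂ cQ₂ s * tadpoleTable n a (slotTab WE WJ WΛ WR WQ s) κ' l' u u') +
        ∑ i : Fin 3, ∑ j : Fin 3, secWt cE cΛ cR i * secWt cE cΛ cR j *
          biBubbleTable (Ga n a) (Ga n a) (secSt n a cK cQ i) (secSt n a cK cQ j) κ' l' u u' := by
  rw [fineHess_apply, tadpoleTable_Wbf_eq_slotSum n a cE₂ cJ4 cΛ₂ cR₂ cQ₂ WE WJ WΛ WR WQ hGa hE hJ hΛ hR hQ,
    bubbleTable_SbfBal_eq_secSum n a cE cVH cΛ cR cK cQ ha hGa]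

/-- [folklore] **THE SAME FOR THE BASE-POINT KERNELS** (`baseKer P b w = P (b + w) b`): the base-point kernel of the `(μ,ν)` entry of the gluon
fine Hessian kernel is the weighted combination of the base-point kernels of the 5 + 9 term tables. -/
theorem baseKer_fineHess_SbfBal_Wbf_eq_terms (ha : 0 < a) (hGa : Spr (Ga n a)) (hE : ∀ κ u l u', Loc (WE κ u l u'))
    (hJ : ∀ κ u l u', Loc (WJ κ u l u')) (hΛ : ∀ κ u l u', Loc (WΛ κ u l u')) (hR : ∀ κ u l u', Loc (WR κ u l u'))
    (hQ : ∀ κ u l u', Loc (WQ κ u l u')) (μ ν : Fin 4) (b w : Site 4) :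
    baseKer (fineHess n a (SbfBal n a cE cVH cΛ cR cK cQ) (Wbf cE₂ cJ4 cΛ₂ cR₂ cQ₂ WE WJ WΛ WR WQ) μ ν) b w =
      (∑ s : Fin 5, slotWt cE₂ cJ4 cΛ₂ cR₂ cQ₂ s * baseKer (tadpoleTable n a (slotTab WE WJ WΛ WR WQ s) μ ν) b w) +
        ∑ i : Fin 3, ∑ j : Fin 3, secWt cE cΛ cR i * secWt cE cΛ cR j *
          baseKer (biBubbleTable (Ga n a) (Ga n a) (secSt n a cK cQ i) (secSt n a cK cQ j) μ ν) b w := by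
  simp only [baseKer]
  exact fineHess_SbfBal_Wbf_eq_terms n a cE cVH cΛ cR cK cQ cE₂ cJ4 cΛ₂ cR₂ cQ₂ WE WJ WΛ WR WQ ha hGa hE hJ hΛ hR hQ μ ν (b + w) b

/-- [folklore] **THE GLUON PIECE'S (F)-INTEGRAND, TERM BY TERM** — the left side of slot (SPLIT) for the reduced gluon piece before the loop
weight: `n⁻⁸·w_μw_ν·baseKer (fineHess …) b w` (`AssemblySlots.hF_TOfRed`'s `Kf`) is the same weighted combination of the 5 + 9 term integrands
`n⁻⁸·w_μw_ν·baseKer (tadpoleTable W_s μ ν) b w`, `n⁻⁸·w_μw_ν·baseKer (biBubbleTable Ga Ga (secSt i) (secSt j) μ ν) b w`. -/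
theorem Kf_gluon_eq_terms (ha : 0 < a) (hGa : Spr (Ga n a)) (hE : ∀ κ u l u', Loc (WE κ u l u'))
    (hJ : ∀ κ u l u', Loc (WJ κ u l u')) (hΛ : ∀ κ u l u', Loc (WΛ κ u l u')) (hR : ∀ κ u l u', Loc (WR κ u l u'))
    (hQ : ∀ κ u l u', Loc (WQ κ u l u')) (μ ν : Fin 4) (b w : Pt) :
    ((n : ℝ) ^ 8)⁻¹ * (toReal w μ * toReal w ν *
        baseKer (fineHess n a (SbfBal n a cE cVH cΛ cR cK cQ) (Wbf cE₂ cJ4 cΛ₂ cR₂ cQ₂ WE WJ WΛ WR WQ) μ ν) b w) =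
      (∑ s : Fin 5, slotWt cE₂ cJ4 cΛ₂ cR₂ cQ₂ s *
          (((n : ℝ) ^ 8)⁻¹ * (toReal w μ * toReal w ν * baseKer (tadpoleTable n a (slotTab WE WJ WΛ WR WQ s) μ ν) b w))) +
        ∑ i : Fin 3, ∑ j : Fin 3, secWt cE cΛ cR i * secWt cE cΛ cR j *
          (((n : ℝ) ^ 8)⁻¹ * (toReal w μ * toReal w ν *
            baseKer (biBubbleTable (Ga n a) (Ga n a) (secSt n a cK cQ i) (secSt n a cK cQ j) μ ν) b w)) := by
  rw [baseKer_fineHess_SbfBal_Wbf_eq_terms n a cE cVH cΛ cR cK cQ cE₂ cJ4 cΛ₂ cR₂ cQ₂ WE WJ WΛ WR WQ ha hGa hE hJ hΛ hR hQ μ ν b w,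
    mul_add, Finset.mul_sum, Finset.mul_sum, mul_add, Finset.mul_sum, Finset.mul_sum]
  congr 1
  · exact Finset.sum_congr rfl fun s _ => by ring
  · refine Finset.sum_congr rfl fun i _ => ?_
    rw [Finset.mul_sum, Finset.mul_sum]
    exact Finset.sum_congr rfl fun j _ => by ring

/-- [folklore] **(CONV) FOR EVERY TADPOLE-SLOT TERM**: a slot table bi-localised at its two fine bonds (uniform constant, positive rate) has a
term integrand with convergent punctured partial sums (`absMoment₂_baseKer_tadpoleTable` + `Assembly.exists_tendsto_psum_weight_mul`). -/
theorem conv_tadpoleTable_slot (hGa : Spr (Ga n a)) {W : TableR} {C2 δ : ℝ} (hW : ∀ κ u l u', BiLoc (W κ u l u') u u' C2 δ) (hδ : 0 < δ)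
    (μ ν : Fin 4) (b : Pt) :
    ∃ B, Tendsto (psum (fun w : Pt => ((n : ℝ) ^ 8)⁻¹ * (toReal w μ * toReal w ν * baseKer (tadpoleTable n a W μ ν) b w))) atTop (𝓝 B) :=
  exists_tendsto_psum_const_mul _ (exists_tendsto_psum_weight_mul (absMoment₂_baseKer_tadpoleTable n a hGa hW hδ μ ν b) μ ν)

/-- [folklore] **(CONV) FOR EVERY TWO-SECTOR BUBBLE TERM** (`0 < a`, `Spr (Ga n a)`): the term integrands of the nine sector words have convergent
punctured partial sums. -/
theorem conv_biBubbleTable_sectors (ha : 0 < a) (hGa : Spr (Ga n a)) (i j : Fin 3) (μ ν : Fin 4) (b : Pt) :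
    ∃ B, Tendsto (psum (fun w : Pt => ((n : ℝ) ^ 8)⁻¹ * (toReal w μ * toReal w ν *
      baseKer (biBubbleTable (Ga n a) (Ga n a) (secSt n a cK cQ i) (secSt n a cK cQ j) μ ν) b w))) atTop (𝓝 B) := by
  obtain ⟨Cs, δs, hδs, hS⟩ := exists_biLoc_secSt n a cK cQ ha i
  obtain ⟨Ct, δt, hδt, hT⟩ := exists_biLoc_secSt n a cK cQ ha j
  exact exists_tendsto_psum_const_mul _
    (exists_tendsto_psum_weight_mul (absMoment₂_baseKer_biBubbleTable (Ga n a) (Ga n a) hGa hGa hS hδs hT hδt μ ν b) μ ν)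

end Summit.QuantumFields.BalabanUV.Beta.D1BFx.FineHessianSectors

end
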